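import Literature.Geometry.Lorentzian.ConvergenceTransport
import Literature.Geometry.Lorentzian.CauchyDevelopment
import Literature.Geometry.Lorentzian.KerrSchild

/-!
# Late charts push forward along development embeddings: the refutation interface for the
no-extremal-remnant clause of `TameCensorship`
(negative-side support for crux `TameCensorship`, `stmt-FinalStateConjecture-17431`, route
`PhotonSphereChannels`; cdisprove seat, cycle 4, 2026-08-17)

Clause (i) of the crux's bundled property forbids, in every MAXIMAL vacuum Cauchy development (MGHD) of
the datum, a late chart (`Spacetime.IsLateChart … Set.univ τ₀ Ψ`: smooth, an open embedding on the late
region) from a boosted extremal Kerr exterior whose truncated `C²` deviation tends to `0` for every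
radius. The disprover's standing obstruction (Cruxes/TameCensorship/Disproof.lean §3/§5) is that no MGHD
is constructible in the tree. This file records that for clause (i) maximality is needed only on the far
side:

* `lateChart_pushforward`: a late chart with decaying truncated `Cᵏ` deviation of a development `𝒟'`
  pushes forward along any development embedding `𝒟' ↪ 𝒟` (`CauchyDevelopment.EmbedsInto`: a smooth,
  isometric open embedding) to a late chart of `𝒟` on the same background with the SAME deviation
  numbers (`Spacetime.deviation_comp`);
* `no_lateChart_of_isMaximal`: hence if an MGHD has no such chart, NO vacuum Cauchy development of the
  datum has one (clause (i) for the MGHD is clause (i) for every globally hyperbolic vacuum development);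
* `isMaximal_violates_noExtremalRemnant`: conversely, ONE vacuum Cauchy development of the datum — maximal
  or not — carrying an extremal-Kerr late chart with decaying `C²` deviation makes EVERY MGHD of the datum
  violate clause (i) verbatim; composed with the crux's `∀ 𝒟, 𝒟.IsMaximal → …` this puts the datum in
  the exceptional set with no appeal to maximality or uniqueness of developments on the near side.

What remains for an actual exceptional datum is a vacuum Cauchy development of a complete one-ended
admissible datum containing an extremal Kerr late region (local well-posedness for glued data + the
Cauchy-surface property), not MGHD theory. The other two clauses (complete `𝓘⁺`, bounded outer
geometry) do NOT push forward along embeddings. Everything here is proved; no definitions.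

O'Neill 1983, Ch. 3, p. 58 (pullbacks compose); Choquet-Bruhat–Geroch 1969 / Ringström 2009,
Def. 16.5 (development embeddings); DHRT arXiv:2104.08222, §1 (deviation, consequence form).
-/

set_option linter.dupNamespace false

noncomputable section

open Set Function Filter Topology
open scoped Manifold ContDiff

namespace Summit.FinalStateConjecture.FinalStateConjecture.Theorems.TameCensorship.Negative

open Literature.Geometry.Lorentzian

variable {X : Type} [TopologicalSpace X] [ChartedSpace E3 X] [IsManifold (𝓡 3) ∞ X]
  [ConnectedSpace X] {D : InitialDataSet (𝓡 3) X}

/-- **Late charts with decaying truncated deviation push forward along development embeddings**, on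
the same background and with the same deviation numbers: compose with the embedding (smoothness and
open embeddings compose; `Spacetime.deviation_comp` for the isometric immersion).
[cite: ONeill1983, Ch. 3, p. 58] -/
theorem lateChart_pushforward {𝒟' 𝒟 : CauchyDevelopment D} (h : 𝒟'.EmbedsInto 𝒟)
    (B : ModelBackground) {k : ℕ} {τ₀ : ℝ} {Ψ : B.domain → 𝒟'.carrier}
    (hΨ : 𝒟'.toSpacetime.IsLateChart B univ τ₀ Ψ)
    (hdev : ∀ R : ℝ, Tendsto (fun τ ↦ 𝒟'.toSpacetime.truncDeviationCk B Ψ k R τ) atTop (𝓝 0)) :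
    ∃ Ψ' : B.domain → 𝒟.carrier, 𝒟.toSpacetime.IsLateChart B univ τ₀ Ψ' ∧
      ∀ R : ℝ, Tendsto (fun τ ↦ 𝒟.toSpacetime.truncDeviationCk B Ψ' k R τ) atTop (𝓝 0) := by
  obtain ⟨ψ, hψs, hψo, hψi, -, -⟩ := h
  refine ⟨ψ ∘ Ψ, ⟨hψs.comp hΨ.contMDiff, hψo.comp hΨ.isOpenEmbedding, subset_univ _⟩, fun R ↦ ?_⟩
  have hcomp : 𝒟.toSpacetime.truncDeviationCk B (ψ ∘ Ψ) k R =
      𝒟'.toSpacetime.truncDeviationCk B Ψ k R := by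
    funext τ
    unfold Spacetime.truncDeviationCk Spacetime.deviationExtend
    rw [Spacetime.deviation_comp B (hψs.mdifferentiable (by simp)) hψi.2
      (hΨ.contMDiff.mdifferentiable (by simp))]
  rw [hcomp]
  exact hdev R

/-- **If a maximal development has no decaying late chart on `B`, no vacuum Cauchy development of the
datum has one** (every vacuum Cauchy development embeds into the maximal one).
[cite: Ringstrom2009, Def. 16.5] -/
theorem no_lateChart_of_isMaximal {𝒟 : VacuumCauchyDevelopment D} (hmax : 𝒟.IsMaximal)
    (B : ModelBackground) {k : ℕ}
    (hno : ¬ ∃ (τ₀ : ℝ) (Ψ : B.domain → 𝒟.carrier), 𝒟.toSpacetime.IsLateChart B univ τ₀ Ψ ∧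
      ∀ R : ℝ, Tendsto (fun τ ↦ 𝒟.toSpacetime.truncDeviationCk B Ψ k R τ) atTop (𝓝 0))
    (𝒟' : VacuumCauchyDevelopment D) :
    ¬ ∃ (τ₀ : ℝ) (Ψ : B.domain → 𝒟'.carrier), 𝒟'.toSpacetime.IsLateChart B univ τ₀ Ψ ∧
      ∀ R : ℝ, Tendsto (fun τ ↦ 𝒟'.toSpacetime.truncDeviationCk B Ψ k R τ) atTop (𝓝 0) := by
  rintro ⟨τ₀, Ψ, hΨ, hdev⟩
  obtain ⟨Ψ', hΨ', hdev'⟩ := lateChart_pushforward (hmax 𝒟') B hΨ hdev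
  exact hno ⟨τ₀, Ψ', hΨ', hdev'⟩

/-- **Refutation interface for the no-extremal-remnant clause.** If SOME vacuum Cauchy development `𝒟'`
of the datum (not necessarily maximal) carries a late chart from a boosted extremal Kerr exterior with
truncated `C²` deviation `→ 0` for every radius, then EVERY maximal vacuum Cauchy development of the
datum violates clause (i) of `PhotonSphereChannels.TameCensorship` / hypothesis (i) of
`ChannelsResolveTameDevelopmentsR`, stated verbatim. [cite: Ringstrom2009, Def. 16.5] -/
theorem isMaximal_violates_noExtremalRemnant (𝒟' : VacuumCauchyDevelopment D)
    {Λ₀ : lorentzGroup} {c₀ : E4} {M₀ a₀ : ℝ} (hext : Kerr.IsExtremal M₀ a₀) {τ₀ : ℝ}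
    {Ψ : (boostedKerrBackground Λ₀ c₀ M₀ a₀).domain → 𝒟'.carrier}
    (hΨ : 𝒟'.toSpacetime.IsLateChart (boostedKerrBackground Λ₀ c₀ M₀ a₀) univ τ₀ Ψ)
    (hdev : ∀ R : ℝ, Tendsto
      (fun τ ↦ 𝒟'.toSpacetime.truncDeviationCk (boostedKerrBackground Λ₀ c₀ M₀ a₀) Ψ 2 R τ)
      atTop (𝓝 0))
    (𝒟 : VacuumCauchyDevelopment D) (hmax : 𝒟.IsMaximal) :
    ¬ ∀ (Λ : lorentzGroup) (c : E4) (M a : ℝ), Kerr.IsExtremal M a →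
      ¬ ∃ (τ₀ : ℝ) (Ψ : (boostedKerrBackground Λ c M a).domain → 𝒟.carrier),
        𝒟.toSpacetime.IsLateChart (boostedKerrBackground Λ c M a) Set.univ τ₀ Ψ ∧
        ∀ R : ℝ, Filter.Tendsto
          (fun τ => 𝒟.toSpacetime.truncDeviationCk (boostedKerrBackground Λ c M a) Ψ 2 R τ)
          Filter.atTop (nhds 0) := by
  intro hall
  obtain ⟨Ψ', hΨ', hdev'⟩ := lateChart_pushforward (hmax 𝒟') (boostedKerrBackground Λ₀ c₀ M₀ a₀) hΨ hdev
  exact hall Λ₀ c₀ M₀ a₀ hext ⟨τ₀, Ψ', hΨ', hdev'⟩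

end Summit.FinalStateConjecture.FinalStateConjecture.Theorems.TameCensorship.Negative

end
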